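import Literature.Probability.LatticeModels.IsoradialPercolation
import Mathlib.MeasureTheory.Constructions.UnitInterval
import Mathlib.Probability.Distributions.Bernoulli
import HarnessLib

/-!
# Resampling one coordinate of an inhomogeneous product Bernoulli measure

Bookkeeping for `prodBernoulli p` (`Literature.Probability.LatticeModels.IsoradialPercolation`):
drawing the coordinate `e` afresh. With an independent uniform variable `U ∈ [0, 1]`,
`resample e w ω U` contains `e` iff `U < w` and agrees with `ω` elsewhere; then

* `map_resample` — `(P_p ⊗ U).map (resample e w) = P_{p[e ↦ w]}` (product measures: the `e`-th
  Bernoulli factor is replaced by `Ber(w)`, the others are untouched; uniqueness of infinite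
  product measures from cylinders, Mathlib's `Measure.eq_infinitePi`).

This is the law of the **insertion of the travelling rhombus** in Grimmett–Manolescu's track
exchange (PTRF 159 (2014) §5.3: "assign a random state to the new 'green' edge with the
distribution appropriate to the isoradial embedding"): a new edge of weight `w`, sampled
independently of everything else (`p e = 0` before the insertion).

## References

* G. Grimmett, *Percolation*, 2nd ed. (1999), §1.3 (product measure).
* G. R. Grimmett, I. Manolescu, PTRF 159 (2014), arXiv:1204.0505, §5.3.
-/

noncomputable section

namespace Literature.Probability.LatticeModels

open MeasureTheory Set

variable {ι : Type*}

/-- Set the coordinate `e` of the configuration `ω` according to the uniform variable `u` and the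
threshold `w`: present iff `u < w`. [folklore] -/
def resample [DecidableEq ι] (e : ι) (w : unitInterval) (ω : Set ι) (u : unitInterval) : Set ι :=
  if (u : ℝ) < w then insert e ω else ω \ {e}

/-- Membership in a resampled configuration. [folklore] -/
theorem mem_resample_iff [DecidableEq ι] (e : ι) (w : unitInterval) (ω : Set ι) (u : unitInterval) (i : ι) :
    i ∈ resample e w ω u ↔ (i ≠ e ∧ i ∈ ω) ∨ (i = e ∧ (u : ℝ) < w) := by
  unfold resample
  split_ifs with h
  · simp only [mem_insert_iff, h, and_true]
    by_cases hi : i = e <;> simp [hi]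
  · simp only [mem_sdiff, mem_singleton_iff, h, and_false, or_false]
    tauto

/-- Resampling is jointly measurable. [folklore] -/
theorem measurable_resample [DecidableEq ι] (e : ι) (w : unitInterval) :
    Measurable fun x : Set ι × unitInterval => resample e w x.1 x.2 := by
  refine measurable_set_iff.2 fun i => ?_
  have h : (fun x : Set ι × unitInterval => i ∈ resample e w x.1 x.2) =
      fun x => (i ≠ e ∧ i ∈ x.1) ∨ (i = e ∧ (x.2 : ℝ) < w) := by
    funext x; exact propext (mem_resample_iff e w x.1 x.2 i)
  rw [h]
  refine Measurable.or (measurable_const.and ((measurable_set_mem i).comp measurable_fst))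
    (measurable_const.and ?_)
  exact measurableSet_setOf.1 ((measurableSet_lt (measurable_subtype_coe.comp measurable_snd) measurable_const))

/-- The probability that the uniform variable falls below `w` is `w`. [folklore] -/
theorem volume_setOf_coe_lt (w : unitInterval) : volume {u : unitInterval | (u : ℝ) < w} = ENNReal.ofReal w := by
  have : {u : unitInterval | (u : ℝ) < w} = Iio w := by ext u; simp [Subtype.coe_lt_coe]
  rw [this, unitInterval.volume_Iio]

/-- **Resampling one coordinate.** Under `P_p ⊗ U`, setting the coordinate `e` to `(U < w)`
produces `P_{p[e ↦ w]}` (product measures: the `e`-th factor is replaced by `Ber(w)`, the others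
are untouched and independent of `U`). [folklore] -/
theorem map_resample [DecidableEq ι] (p : ι → unitInterval) (e : ι) (w : unitInterval) :
    ((prodBernoulli p).prod (volume : Measure unitInterval)).map
        (fun x : Set ι × unitInterval => resample e w x.1 x.2) = prodBernoulli (Function.update p e w) := by
  classical
  -- the Bernoulli factors
  set B : (ι → unitInterval) → ι → Measure Prop := fun r i =>
    unitInterval.toNNReal (r i) • Measure.dirac True +
      unitInterval.toNNReal (unitInterval.symm (r i)) • Measure.dirac False with hB
  haveI hprob : ∀ r i, IsProbabilityMeasure (B r i) := fun r i => by
    simp only [hB]; infer_instance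
  have h1 : ∀ r, prodBernoulli r = (Measure.infinitePi (B r)).map (fun q : ι → Prop => {i | q i}) :=
    fun r => prodBernoulli_eq_map r
  -- the coordinates of the resampled configuration
  set toFun : Set ι → ι → Prop := fun ω i => i ∈ ω with htoFun
  have htoFun_meas : Measurable toFun := measurable_pi_lambda _ fun i => measurable_set_mem i
  have hinv : ∀ ω : Set ι, {i | toFun ω i} = ω := fun ω => rfl
  -- it suffices to identify the law of the coordinates
  suffices key : (((prodBernoulli p).prod (volume : Measure unitInterval)).map
      (fun x : Set ι × unitInterval => resample e w x.1 x.2)).map toFun = Measure.infinitePi (B (Function.update p e w)) by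
    rw [h1 (Function.update p e w), ← key, Measure.map_map measurable_setOf htoFun_meas]
    have : (fun q : ι → Prop => {i | q i}) ∘ toFun = id := by funext ω; rfl
    rw [this, Measure.map_id]
  rw [Measure.map_map htoFun_meas (measurable_resample e w)]
  refine Measure.eq_infinitePi _ fun s t ht => ?_
  rw [Measure.map_apply (htoFun_meas.comp (measurable_resample e w))
    (MeasurableSet.pi s.countable_toSet fun i _ => ht i)]
  -- the preimage of a cylinder is a product of a cylinder and an interval event
  set s' : Finset ι := s.erase e with hs'
  set C : Set (Set ι) := {ω | ∀ i ∈ s', (i ∈ ω) ∈ t i} with hC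
  set J : Set unitInterval := if e ∈ s then {u | ((u : ℝ) < w) ∈ t e} else univ with hJ
  have hmemC : ∀ (ω : Set ι) (u : unitInterval) (i : ι), i ≠ e →
      ((i ∈ resample e w ω u) ↔ (i ∈ ω)) := by
    intro ω u i hie
    rw [mem_resample_iff]
    exact ⟨fun h' => h'.elim And.right (fun h'' => absurd h''.1 hie), fun h' => Or.inl ⟨hie, h'⟩⟩
  have hmemE : ∀ (ω : Set ι) (u : unitInterval), ((e ∈ resample e w ω u) ↔ ((u : ℝ) < w)) := by
    intro ω u
    rw [mem_resample_iff]
    exact ⟨fun h' => h'.elim (fun h'' => absurd rfl h''.1) And.right, fun h' => Or.inr ⟨rfl, h'⟩⟩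
  have hpre : (toFun ∘ fun x : Set ι × unitInterval => resample e w x.1 x.2) ⁻¹' Set.pi (↑s) t = C ×ˢ J := by
    ext ⟨ω, u⟩
    simp only [mem_preimage, Function.comp_apply, mem_pi, Finset.mem_coe, mem_prod, hC, mem_setOf_eq, hs',
      Finset.mem_erase, htoFun]
    constructor
    · intro h
      refine ⟨fun i ⟨hie, his⟩ => ?_, ?_⟩
      · have := h i his
        rwa [propext (hmemC ω u i hie)] at this
      · rw [hJ]
        by_cases hes : e ∈ s
        · rw [if_pos hes, mem_setOf_eq]
          have := h e hes
          rwa [propext (hmemE ω u)] at this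
        · rw [if_neg hes]; exact mem_univ _
    · rintro ⟨hCω, hJu⟩ i his
      by_cases hie : i = e
      · subst hie
        rw [hJ, if_pos his, mem_setOf_eq] at hJu
        rwa [propext (hmemE ω u)]
      · rw [propext (hmemC ω u i hie)]
        exact hCω i ⟨hie, his⟩
  rw [hpre, Measure.prod_prod]
  -- the cylinder factor
  have hCmeas : MeasurableSet C := by
    have : C = toFun ⁻¹' Set.pi (↑s') t := by ext ω; simp [hC, htoFun]
    rw [this]
    exact htoFun_meas (MeasurableSet.pi s'.countable_toSet fun i _ => ht i)
  have hCyl : prodBernoulli p C = ∏ i ∈ s', B p i (t i) := by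
    rw [h1 p, Measure.map_apply measurable_setOf hCmeas]
    have : (fun q : ι → Prop => {i | q i}) ⁻¹' C = Set.pi (↑s') t := by ext q; simp [hC]
    rw [this, Measure.infinitePi_pi _ (fun i _ => ht i)]
  -- the interval factor
  have hBdef : ∀ r i, B r i = ProbabilityTheory.bernoulliMeasure True False (r i) := fun r i => rfl
  have hcoe : ∀ v : unitInterval, ENNReal.ofReal (v : ℝ) = (unitInterval.toNNReal v : ENNReal) := fun v => by
    rw [ENNReal.ofReal_eq_coe_nnreal v.2.1]; rfl
  have hBe : ∀ T : Set Prop, volume ({u : unitInterval | ((u : ℝ) < w) ∈ T}) = B (Function.update p e w) e T := by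
    intro T
    have hT : MeasurableSet T := MeasurableSpace.measurableSet_top
    have hlt : ∀ u : unitInterval, ((u : ℝ) < w) = (u < w) := fun u => propext Subtype.coe_lt_coe
    rw [hBdef, Function.update_self]
    simp only [hlt]
    by_cases h1 : True ∈ T <;> by_cases h2 : False ∈ T
    · have : {u : unitInterval | (u < w) ∈ T} = (univ : Set unitInterval) := by
        ext u; by_cases hu : u < w <;> simp [hu, h1, h2]
      rw [this, measure_univ, ProbabilityTheory.bernoulliMeasure_apply_of_mem_of_mem _ hT h1 h2]
    · have : {u : unitInterval | (u < w) ∈ T} = Iio w := by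
        ext u; by_cases hu : u < w <;> simp [hu, h1, h2]
      rw [this, unitInterval.volume_Iio, ProbabilityTheory.bernoulliMeasure_apply_of_mem_of_notMem _ hT h1 h2, hcoe]
    · have : {u : unitInterval | (u < w) ∈ T} = (Iio w)ᶜ := by
        ext u; by_cases hu : u < w <;> simp [hu, h1, h2, le_of_not_gt]
      rw [this, measure_compl measurableSet_Iio (measure_ne_top _ _), measure_univ, unitInterval.volume_Iio,
        ProbabilityTheory.bernoulliMeasure_apply_of_notMem_of_mem _ hT h1 h2, ← hcoe (unitInterval.symm w),
        unitInterval.coe_symm_eq, ENNReal.ofReal_sub _ w.2.1, ENNReal.ofReal_one]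
    · have : {u : unitInterval | (u < w) ∈ T} = (∅ : Set unitInterval) := by
        ext u; by_cases hu : u < w <;> simp [hu, h1, h2]
      rw [this, measure_empty, ProbabilityTheory.bernoulliMeasure_apply_of_notMem_of_notMem _ hT h1 h2]
  -- assemble
  by_cases hes : e ∈ s
  · rw [hJ, if_pos hes, hCyl, hBe, ← Finset.prod_erase_mul s _ hes]
    congr 1
    refine Finset.prod_congr rfl fun i hi => ?_
    rw [Finset.mem_erase] at hi
    rw [hBdef, hBdef, Function.update_of_ne hi.1]
  · rw [hJ, if_neg hes, measure_univ, mul_one, hCyl]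
    have hs'eq : s' = s := Finset.erase_eq_of_notMem hes
    rw [hs'eq]
    refine Finset.prod_congr rfl fun i hi => ?_
    have hie : i ≠ e := fun h => hes (h ▸ hi)
    rw [hBdef, hBdef, Function.update_of_ne hie]

end Literature.Probability.LatticeModels
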